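import Mathlib
import HarnessLib

/-!
# Route `PoloidalWindowDoor`, item `LrcModEntire` (stmt-NavierStokesRegularity-20428), cell (Q4-curved), VERTICAL child, residue `…UniformlyCurvedNoAsymptoticPeriod` —
# ¬Y_P″ IS HEREDITARY ALONG THE TRANSLATION HULL: an asymptotic translation period of a translation LIMIT of the base curve is an asymptotic translation period of the base curve

Cell ns-regularity-ideate, stub-worker seat ns-poloidal-K2-p2 g19 under the LEAD of item 20428 (ns-poloidal-K2-p3 g18); `--supports stmt-NavierStokesRegularity-20428
--as helper`.  Class-free curve bookkeeping (PRICE 2 of idea-crit-7 g12's Duty-C 2026-08-30T05:05:02Z on memo `Y-LADDER-K2p2g19.md` §6(a)): after v19 the (Q4) residue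
carries the literal ¬Y_P″ «the base curve `Γ` has NO asymptotic translation period along any sequence of arcs»; the hull step (`…RidgeHullIterate.exists_hullLimit_branch_reentry`)
replaces `(U, Γ)` by a translation limit `(U′, Γ′)`, `Γ(a n + s) − Γ(a n) → Γ′(s)`; this file shows that ¬Y_P″ passes to `Γ′` (so that a uniformly recurrent representative —
K2-p2 g15 `…RidgeWebRecurrent.exists_uniformlyRecurrent_ridgeWeb` — keeps the literal).

* `lipschitz_of_tendsto_translates` — a pointwise limit of re-based translates of a 1-Lipschitz curve is 1-Lipschitz;
* `tendstoLocallyUniformly_translates` — for a 1-Lipschitz curve, pointwise convergence of the re-based translates is locally uniform (equi-Lipschitz ⇒ ε/3);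
* ★ `exists_asymptoticPeriod_of_limit` — if `Γ(a n + s) − Γ(a n) → Γ′(s)` for every `s` (Γ 1-Lipschitz, e.g. unit speed) and `Γ′(b n + s + L) − Γ′(b n + s) → τ` for every `s`,
  then `Γ(c n + s + L) − Γ(c n + s) → τ` for every `s` along the DIAGONAL base sequence `c n := a (j n) + b n` (uniform convergence on the windows `[−(|b n| + |L| + n + 1), …]`);
* ★ `not_asymptoticPeriod_of_limit` — contrapositive in the registry's spelling: ¬Y_P″ for `Γ` ⇒ ¬Y_P″ for `Γ′`.

WHAT THIS IS NOT: not a claim about Navier–Stokes regularity; elementary bookkeeping for the research residue of the (Q4) column (registry v19 of item 20428); closes nothing;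
items 20428 / 19708 / 27893 OPEN (bears_on LADDER-NS N0).
-/

noncomputable section

set_option linter.dupNamespace false
set_option linter.style.longLine false

namespace Summit.NavierStokesRegularity.NavierStokesRegularity.Theorems.PoloidalWindowDoorLrcModEntireQ4CurvedAsymptoticPeriodHereditary

open Set Function Filter Topology Metric

variable {Γ Γ' : ℝ → EuclideanSpace ℝ (Fin 3)} {a : ℕ → ℝ}

/-- A pointwise limit of re-based translates of a 1-Lipschitz curve is 1-Lipschitz. -/
theorem lipschitz_of_tendsto_translates (hL : ∀ s s' : ℝ, dist (Γ s) (Γ s') ≤ dist s s')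
    (hlim : ∀ s : ℝ, Tendsto (fun n => Γ (a n + s) - Γ (a n)) atTop (𝓝 (Γ' s))) (s s' : ℝ) :
    dist (Γ' s) (Γ' s') ≤ dist s s' := by
  have h := (hlim s).dist (hlim s')
  refine le_of_tendsto h (Eventually.of_forall fun n => ?_)
  have h1 : dist (Γ (a n + s) - Γ (a n)) (Γ (a n + s') - Γ (a n)) = dist (Γ (a n + s)) (Γ (a n + s')) := by
    rw [dist_eq_norm, dist_eq_norm]; congr 1; abel
  rw [h1]
  have h2 := hL (a n + s) (a n + s')
  have h3 : dist (a n + s) (a n + s') = dist s s' := by rw [Real.dist_eq, Real.dist_eq]; congr 1; ring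
  rwa [h3] at h2

/-- **Equi-Lipschitz ⇒ locally uniform**: for a 1-Lipschitz curve, pointwise convergence of the re-based translates is locally uniform. -/
theorem tendstoLocallyUniformly_translates (hL : ∀ s s' : ℝ, dist (Γ s) (Γ s') ≤ dist s s')
    (hlim : ∀ s : ℝ, Tendsto (fun n => Γ (a n + s) - Γ (a n)) atTop (𝓝 (Γ' s))) :
    TendstoLocallyUniformly (fun n s => Γ (a n + s) - Γ (a n)) Γ' atTop := by
  rw [Metric.tendstoLocallyUniformly_iff]
  intro ε hε x
  refine ⟨ball x (ε / 3), ball_mem_nhds x (by positivity), ?_⟩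
  have hx := Metric.tendsto_nhds.1 (hlim x) (ε / 3) (by positivity)
  filter_upwards [hx] with n hn y hy
  have hy' : dist y x < ε / 3 := mem_ball.1 hy
  have h1 : dist (Γ' y) (Γ' x) ≤ dist y x := lipschitz_of_tendsto_translates hL hlim y x
  have h2 : dist (Γ (a n + x) - Γ (a n)) (Γ (a n + y) - Γ (a n)) ≤ dist y x := by
    have h := hL (a n + x) (a n + y)
    rw [dist_eq_norm] at h ⊢
    have e : Γ (a n + x) - Γ (a n) - (Γ (a n + y) - Γ (a n)) = Γ (a n + x) - Γ (a n + y) := by abel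
    rw [e]
    have h3 : dist (a n + x) (a n + y) = dist y x := by rw [Real.dist_eq, Real.dist_eq, abs_sub_comm]; congr 1; ring
    rwa [h3] at h
  calc dist (Γ' y) (Γ (a n + y) - Γ (a n))
      ≤ dist (Γ' y) (Γ' x) + dist (Γ' x) (Γ (a n + x) - Γ (a n)) + dist (Γ (a n + x) - Γ (a n)) (Γ (a n + y) - Γ (a n)) :=
        dist_triangle4 _ _ _ _
    _ < ε / 3 + ε / 3 + ε / 3 := by
        have hn' : dist (Γ' x) (Γ (a n + x) - Γ (a n)) < ε / 3 := by rw [dist_comm]; exact hn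
        linarith [h1.trans_lt hy', h2.trans_lt hy']
    _ = ε := by ring

/-- ★ **An asymptotic translation period of a translation limit is an asymptotic translation period of the curve** (diagonal base sequence). -/
theorem exists_asymptoticPeriod_of_limit (hL : ∀ s s' : ℝ, dist (Γ s) (Γ s') ≤ dist s s')
    (hlim : ∀ s : ℝ, Tendsto (fun n => Γ (a n + s) - Γ (a n)) atTop (𝓝 (Γ' s)))
    {b : ℕ → ℝ} {L : ℝ} {τ : EuclideanSpace ℝ (Fin 3)} (hper : ∀ s : ℝ, Tendsto (fun n => Γ' (b n + s + L) - Γ' (b n + s)) atTop (𝓝 τ)) :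
    ∃ c : ℕ → ℝ, ∀ s : ℝ, Tendsto (fun n => Γ (c n + s + L) - Γ (c n + s)) atTop (𝓝 τ) := by
  set F : ℕ → ℝ → EuclideanSpace ℝ (Fin 3) := fun n s => Γ (a n + s) - Γ (a n) with hF_def
  have hlu : TendstoLocallyUniformly F Γ' atTop := tendstoLocallyUniformly_translates hL hlim
  -- uniform convergence on the growing windows `K n := [b n − R n, b n + R n]`, `R n := |L| + n + 1`
  have hwin : ∀ n : ℕ, ∃ j : ℕ, ∀ y ∈ Icc (b n - (|L| + n + 1)) (b n + (|L| + n + 1)), dist (Γ' y) (F j y) < 1 / ((n : ℝ) + 1) := by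
    intro n
    have hK : IsCompact (Icc (b n - (|L| + n + 1)) (b n + (|L| + n + 1))) := isCompact_Icc
    have hU : TendstoUniformlyOn F Γ' atTop (Icc (b n - (|L| + n + 1)) (b n + (|L| + n + 1))) :=
      (tendstoLocallyUniformlyOn_iff_tendstoUniformlyOn_of_compact hK).1 hlu.tendstoLocallyUniformlyOn
    have h := Metric.tendstoUniformlyOn_iff.1 hU (1 / ((n : ℝ) + 1)) (by positivity)
    exact h.exists
  choose j hj using hwin
  refine ⟨fun n => a (j n) + b n, fun s => ?_⟩
  -- the diagonal increments are `2/(n+1)`-close to the increments of `Γ′` along `b n`, which tend to `τ`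
  rw [Metric.tendsto_atTop]
  intro ε hε
  obtain ⟨N₁, hN₁⟩ := Metric.tendsto_atTop.1 (hper s) (ε / 2) (by positivity)
  obtain ⟨N₂, hN₂⟩ := exists_nat_gt (max |s| (4 / ε))
  refine ⟨max N₁ N₂, fun n hn => ?_⟩
  have hn₁ : N₁ ≤ n := le_trans (le_max_left _ _) hn
  have hn₂ : (N₂ : ℝ) ≤ n := by exact_mod_cast le_trans (le_max_right _ _) hn
  have hs_le : |s| ≤ (n : ℝ) := by linarith [(le_max_left |s| (4 / ε)).trans_lt hN₂]
  have hεn : 2 / ((n : ℝ) + 1) < ε / 2 := by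
    have h4 : 4 / ε < (n : ℝ) + 1 := by linarith [(le_max_right |s| (4 / ε)).trans_lt hN₂]
    have hpos : (0 : ℝ) < (n : ℝ) + 1 := by positivity
    rw [div_lt_iff₀ hpos]
    have := (div_lt_iff₀ hε).1 h4
    linarith
  -- the two evaluation points lie in the window `K n`
  have hmem1 : b n + s + L ∈ Icc (b n - (|L| + n + 1)) (b n + (|L| + n + 1)) := by
    constructor <;> nlinarith [abs_le.1 hs_le, neg_abs_le L, le_abs_self L, abs_nonneg L]
  have hmem2 : b n + s ∈ Icc (b n - (|L| + n + 1)) (b n + (|L| + n + 1)) := by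
    constructor <;> nlinarith [abs_le.1 hs_le, abs_nonneg L]
  have h1 := hj n _ hmem1
  have h2 := hj n _ hmem2
  -- the diagonal increment in terms of `F (j n)`
  have hincr : Γ (a (j n) + b n + s + L) - Γ (a (j n) + b n + s) = F (j n) (b n + s + L) - F (j n) (b n + s) := by
    simp only [hF_def]
    have e1 : a (j n) + (b n + s + L) = a (j n) + b n + s + L := by ring
    have e2 : a (j n) + (b n + s) = a (j n) + b n + s := by ring
    rw [e1, e2]; abel
  rw [hincr]
  have hclose : dist (F (j n) (b n + s + L) - F (j n) (b n + s)) (Γ' (b n + s + L) - Γ' (b n + s)) < ε / 2 := by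
    calc dist (F (j n) (b n + s + L) - F (j n) (b n + s)) (Γ' (b n + s + L) - Γ' (b n + s))
        ≤ dist (F (j n) (b n + s + L)) (Γ' (b n + s + L)) + dist (F (j n) (b n + s)) (Γ' (b n + s)) := dist_sub_sub_le _ _ _ _
      _ < 1 / ((n : ℝ) + 1) + 1 / ((n : ℝ) + 1) := by rw [dist_comm] at h1 h2; exact add_lt_add h1 h2
      _ = 2 / ((n : ℝ) + 1) := by ring
      _ < ε / 2 := hεn
  calc dist (F (j n) (b n + s + L) - F (j n) (b n + s)) τ
      ≤ dist (F (j n) (b n + s + L) - F (j n) (b n + s)) (Γ' (b n + s + L) - Γ' (b n + s)) + dist (Γ' (b n + s + L) - Γ' (b n + s)) τ :=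
        dist_triangle _ _ _
    _ < ε / 2 + ε / 2 := add_lt_add hclose (hN₁ n hn₁)
    _ = ε := by ring

/-- ★ **¬Y_P″ is hereditary** (registry spelling): if `Γ` has no asymptotic translation period along any sequence of arcs, neither has any translation limit `Γ′`. -/
theorem not_asymptoticPeriod_of_limit (hL : ∀ s s' : ℝ, dist (Γ s) (Γ s') ≤ dist s s')
    (hlim : ∀ s : ℝ, Tendsto (fun n => Γ (a n + s) - Γ (a n)) atTop (𝓝 (Γ' s)))
    (hno : ¬ (∃ (c : ℕ → ℝ) (L : ℝ) (τ : EuclideanSpace ℝ (Fin 3)), L ≠ 0 ∧ ∀ s : ℝ, Tendsto (fun n : ℕ => Γ (c n + s + L) - Γ (c n + s)) atTop (𝓝 τ))) :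
    ¬ (∃ (b : ℕ → ℝ) (L : ℝ) (τ : EuclideanSpace ℝ (Fin 3)), L ≠ 0 ∧ ∀ s : ℝ, Tendsto (fun n : ℕ => Γ' (b n + s + L) - Γ' (b n + s)) atTop (𝓝 τ)) := by
  rintro ⟨b, L, τ, hL0, hper⟩
  obtain ⟨c, hc⟩ := exists_asymptoticPeriod_of_limit hL hlim hper
  exact hno ⟨c, L, τ, hL0, hc⟩

/-- Unit-speed `C¹` curves are 1-Lipschitz (the form of `hL` used above, from the package clauses `ContDiff ℝ ∞ Γ`, `‖deriv Γ s‖ = 1`). -/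
theorem dist_le_of_unitSpeed (hΓ : Differentiable ℝ Γ) (hunit : ∀ s, ‖deriv Γ s‖ ≤ 1) (s s' : ℝ) : dist (Γ s) (Γ s') ≤ dist s s' := by
  have h := Convex.norm_image_sub_le_of_norm_deriv_le (f := Γ) (s := univ) (fun x _ => hΓ x) (fun x _ => hunit x) convex_univ (mem_univ s') (mem_univ s)
  rw [dist_eq_norm, dist_eq_norm]
  simpa [Real.norm_eq_abs] using h

end Summit.NavierStokesRegularity.NavierStokesRegularity.Theorems.PoloidalWindowDoorLrcModEntireQ4CurvedAsymptoticPeriodHereditary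

end
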